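import Mathlib
import Literature.Analysis.PDE.Wave1DFluxBookkeeping
import HarnessLib

/-!
# Spatial reflection `x ↦ −x` for `ψ_tt − ψ_xx + V(x)ψ = 0` and the far-side infinite-energy channels

Analysis/PDE support file (everything proved). If `ψ` is a `C²` solution of
`ψ_tt − ψ_xx + V(x)ψ = 0` then `ψ♭(t,x) = ψ(t,−x)` is a `C²` solution of the equation with potential
`V(−x)`, with energy density `e♭(t,x) = e(t,−x)` (`wave1D_spatialReflection`), and lower Lebesgue
energies on `Iio (−a)` of `e♭` are those of `e` on `Ioi a` (`lintegral_Iio_reflect`). Consequently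
the near-side infinite-energy bookkeeping of `Wave1DFluxBookkeeping.lean` transfers to the far side:
if `∫⁻_{x > a} e(0,·) = ∞` then `∫⁻_{x > a + |t|} e(t,·) = ∞` for every `t`
(`wave1D_farEnergy_eq_top_of_initial_eq_top`) — two-sided channel inequalities hold trivially for
infinite-energy far data (route PhotonSphereChannels, `FixedModeChannels`, far side,
stmt-FinalStateConjecture-10048). Folklore.
-/

noncomputable section

namespace Literature.Analysis.PDE

open MeasureTheory Set Filter Topology

variable {V : ℝ → ℝ} {ψ : ℝ → ℝ → ℝ}

/-- Lower Lebesgue integrals on `Iio (−a)` of a reflected function are those on `Ioi a`.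
[folklore] -/
theorem lintegral_Iio_reflect (f : ℝ → ENNReal) (a : ℝ) :
    ∫⁻ x in Iio (-a), f (-x) = ∫⁻ x in Ioi a, f x := by
  have h1 : ∫⁻ x in Iio (-a), f (-x) = ∫⁻ x, (Ioi a).indicator f (-x) := by
    rw [← lintegral_indicator measurableSet_Iio]
    congr 1; funext x
    have : x ∈ Iio (-a) ↔ -x ∈ Ioi a := by
      simp only [mem_Iio, mem_Ioi]; constructor <;> intro h <;> linarith
    by_cases hx : x ∈ Iio (-a)
    · rw [indicator_of_mem hx, indicator_of_mem (this.1 hx)]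
    · rw [indicator_of_notMem hx, indicator_of_notMem (mt this.2 hx)]
  rw [h1, lintegral_neg_eq_self, lintegral_indicator measurableSet_Ioi]

/-- **Spatial reflection**: `ψ♭(t,x) = ψ(t,−x)` is a `C²` solution with potential `V(−x)` and
energy density `e(t,−x)`. [folklore] -/
theorem wave1D_spatialReflection (hψ : ContDiff ℝ 2 (Function.uncurry ψ))
    (hsol : ∀ t x, iteratedDeriv 2 (fun τ => ψ τ x) t - iteratedDeriv 2 (ψ t) x + V x * ψ t x = 0) :
    ContDiff ℝ 2 (Function.uncurry fun t x => ψ t (-x)) ∧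
    (∀ t x, iteratedDeriv 2 (fun τ => (fun t x => ψ t (-x)) τ x) t
        - iteratedDeriv 2 ((fun t x => ψ t (-x)) t) x + V (-x) * (fun t x => ψ t (-x)) t x = 0) ∧
    (∀ t x, deriv (fun τ => (fun t x => ψ t (-x)) τ x) t ^ 2 + deriv ((fun t x => ψ t (-x)) t) x ^ 2
        + V (-x) * (fun t x => ψ t (-x)) t x ^ 2
      = deriv (fun τ => ψ τ (-x)) t ^ 2 + deriv (ψ t) (-x) ^ 2 + V (-x) * ψ t (-x) ^ 2) := by
  refine ⟨?_, fun t x => ?_, fun t x => ?_⟩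
  · have : (Function.uncurry fun t x => ψ t (-x))
        = Function.uncurry ψ ∘ fun p : ℝ × ℝ => (p.1, -p.2) := by
      funext p; rfl
    rw [this]
    exact hψ.comp (contDiff_id.prodMap contDiff_neg)
  · have h := hsol t (-x)
    have h2 : iteratedDeriv 2 (fun y => ψ t (-y)) x = iteratedDeriv 2 (ψ t) (-x) := by
      rw [iteratedDeriv_comp_neg 2 (ψ t) x]; norm_num
    show iteratedDeriv 2 (fun τ => ψ τ (-x)) t - iteratedDeriv 2 (fun y => ψ t (-y)) x
      + V (-x) * ψ t (-x) = 0
    rw [h2]; exact h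
  · show deriv (fun τ => ψ τ (-x)) t ^ 2 + deriv (fun y => ψ t (-y)) x ^ 2 + V (-x) * ψ t (-x) ^ 2 = _
    rw [deriv_comp_neg (ψ t) x, even_two.neg_pow]

/-- **Infinite initial far energy forces infinite far-channel energy, both time directions**:
if `∫⁻_{x > a} e(0,·) = ∞` then `∫⁻_{x > a + |t|} e(t,·) = ∞` for every `t`. [folklore] -/
theorem wave1D_farEnergy_eq_top_of_initial_eq_top (hV : Continuous V) (hV0 : ∀ x, 0 ≤ V x)
    (hψ : ContDiff ℝ 2 (Function.uncurry ψ))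
    (hsol : ∀ t x, iteratedDeriv 2 (fun τ => ψ τ x) t - iteratedDeriv 2 (ψ t) x + V x * ψ t x = 0)
    {a : ℝ} (htop : ∫⁻ x in Ioi a, ENNReal.ofReal
        (deriv (fun τ => ψ τ x) 0 ^ 2 + deriv (ψ 0) x ^ 2 + V x * ψ 0 x ^ 2) = ⊤) (t : ℝ) :
    ∫⁻ x in Ioi (a + |t|), ENNReal.ofReal
        (deriv (fun τ => ψ τ x) t ^ 2 + deriv (ψ t) x ^ 2 + V x * ψ t x ^ 2) = ⊤ := by
  obtain ⟨hψ', hsol', he'⟩ := wave1D_spatialReflection hψ hsol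
  have hV' : Continuous fun x => V (-x) := hV.comp continuous_neg
  have hV0' : ∀ x, 0 ≤ V (-x) := fun x => hV0 _
  -- initial energy of the reflected solution on `Iio (−a)` is infinite
  have htop' : ∫⁻ x in Iio (-a), ENNReal.ofReal
      (deriv (fun τ => (fun t x => ψ t (-x)) τ x) 0 ^ 2 + deriv ((fun t x => ψ t (-x)) 0) x ^ 2
        + V (-x) * (fun t x => ψ t (-x)) 0 x ^ 2) = ⊤ := by
    simp only [he']
    rw [lintegral_Iio_reflect (fun x => ENNReal.ofReal
      (deriv (fun τ => ψ τ x) 0 ^ 2 + deriv (ψ 0) x ^ 2 + V x * ψ 0 x ^ 2)) a]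
    exact htop
  have h := wave1D_nearEnergy_eq_top_of_initial_eq_top hV' hV0' hψ' hsol' htop' t
  simp only [he'] at h
  rw [show -a - |t| = -(a + |t|) by ring, lintegral_Iio_reflect (fun x => ENNReal.ofReal
    (deriv (fun τ => ψ τ x) t ^ 2 + deriv (ψ t) x ^ 2 + V x * ψ t x ^ 2)) (a + |t|)] at h
  exact h

end Literature.Analysis.PDE
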